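import Summits.Ventures.PercRepro.C026PFunUnionProd
import Summits.Ventures.PercRepro.C026PFunLeaf

/-!
# Gluing a pendant skeleton at the probe (p6, gen 16; mine-3 §28 (i), the star of subtrees)

`IsGlue G F₀ e F₁ c u`: the skeleton `F = F₀ ∪ insert e F₁` is the old skeleton `F₀` (probe `c`),
a new root edge `e = cu`, and a pendant skeleton `F₁` with root `u`, where `F₀` and `F₁` are
vertex-disjoint, `F₁` does not touch `c` and `F₀` does not touch `u`.  For `ω₀ ⊆ F₀`, `ω₁ ⊆ F₁`
and `ρ = ∏_v (2 − x_v)`: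
- `e` closed (`ω = ω₀ ⊔ ω₁`): `X_c, K_c` are those of `ω₀` and `ρ·N_c(ω) = N_c(ω₀)·n̄(ω₁)`;
- `e` open (`ω⁺ = ω + e`): `X_c(ω⁺) = X_c(ω₀)X_u(ω₁)`, `K_c(ω⁺) = K_c(ω₀)K_u(ω₁)` and
  `ρ·N_c(ω⁺) = N_c(ω₀)·N_u(ω₁)` (the merge identity `(2−X_c)(2−X_u)·n̄(ω⁺) = (2 − X_cX_u)·n̄(ω)`);
- complements: `(ω₀ ⊔ ω₁)^c = (ω₀^c ⊔ ω₁^c) + e` and `(ω⁺)^c = ω₀^c ⊔ ω₁^c`.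
-/

namespace PercRepro

namespace MultiGraph

open Finset

variable {V E : Type*} [Fintype V] [DecidableEq V] [Fintype E] [DecidableEq E] {G : MultiGraph V E}

omit [Fintype E] in
/-- The merge identity for `n̄`: opening `e = ab` with `a ≁ b` replaces the factors
`(2 − X_a)(2 − X_b)` by `2 − X_aX_b`. -/
theorem merge_nbar_identity (x : V → ℝ) {ω : Config E} {e : E}
    (h : ¬ G.Conn ω (G.fst e) (G.snd e)) :
    (2 - G.xCluster x (G.fst e) ω) * (2 - G.xCluster x (G.snd e) ω) *
        G.nbar x (Function.update ω e true) =
      (2 - G.xCluster x (G.fst e) ω * G.xCluster x (G.snd e) ω) * G.nbar x ω := by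
  rw [nbar_update_true_of_not_conn x h, nbar_eq_of_not_conn x h]
  unfold xCluster
  ring

/-- `IsGlue G F₀ e F₁ c u`: the root edge `e = cu` glues the pendant skeleton `F₁` (root `u`) to the
skeleton `F₀` (probe `c`); `F₀`, `F₁` vertex-disjoint, `F₁` avoids `c`, `F₀` avoids `u`. -/
structure IsGlue (G : MultiGraph V E) (F₀ : Finset E) (e : E) (F₁ : Finset E) (c u : V) : Prop where
  vdisj : G.VDisjoint F₀ F₁
  notMem₀ : e ∉ F₀
  notMem₁ : e ∉ F₁
  fst : G.fst e = c
  snd : G.snd e = u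
  ne : u ≠ c
  avoid_c : ¬ G.Touches F₁ c
  avoid_u : ¬ G.Touches F₀ u

section Glue

variable {F₀ F₁ : Finset E} {e : E} {c u : V} (hg : IsGlue G F₀ e F₁ c u) {ω₀ ω₁ : Config E}
  (h₀ : ω₀ ∈ configsIn F₀) (h₁ : ω₁ ∈ configsIn F₁) (x K : V → ℝ)
include hg h₀ h₁

omit [DecidableEq V] in
/-- The cluster of the probe in the join is its cluster in `ω₀`. -/
theorem IsGlue.clusterF_join_c : G.clusterF (join ω₀ ω₁) c = G.clusterF ω₀ c :=
  clusterF_join_left hg.vdisj h₀ h₁ hg.avoid_c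

omit [DecidableEq V] in
/-- The cluster of the pendant root in the join is its cluster in `ω₁`. -/
theorem IsGlue.clusterF_join_u : G.clusterF (join ω₀ ω₁) u = G.clusterF ω₁ u :=
  clusterF_join_right hg.vdisj h₀ h₁ hg.avoid_u

omit [DecidableEq V] in
/-- The probe and the pendant root are not connected in the join. -/
theorem IsGlue.not_conn_join : ¬ G.Conn (join ω₀ ω₁) (G.fst e) (G.snd e) := by
  rw [hg.fst, hg.snd]
  intro hc
  have hu : u ∈ G.clusterF ω₀ c := by
    rw [← hg.clusterF_join_c h₀ h₁]
    exact mem_clusterF.2 hc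
  have hiso : G.clusterF ω₀ u = {u} := clusterF_eq_singleton_of_not_touches h₀ hg.avoid_u
  have : c ∈ G.clusterF ω₀ u := by
    rw [← clusterF_eq_of_conn (mem_clusterF.1 hu)]
    exact self_mem_clusterF ω₀ c
  rw [hiso, Finset.mem_singleton] at this
  exact hg.ne this.symm

omit [DecidableEq V] x K in
/-- The two clusters to be merged are disjoint. -/
theorem IsGlue.disjoint_clusters : Disjoint (G.clusterF ω₀ c) (G.clusterF ω₁ u) := by
  have := disjoint_clusterF_of_not_conn (hg.not_conn_join h₀ h₁)
  rwa [hg.fst, hg.snd, hg.clusterF_join_c h₀ h₁, hg.clusterF_join_u h₀ h₁] at this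

/-- The cluster of the probe after opening the root edge. -/
theorem IsGlue.clusterF_open :
    G.clusterF (Function.update (join ω₀ ω₁) e true) c = G.clusterF ω₀ c ∪ G.clusterF ω₁ u := by
  have h := clusterF_update_true_of_conn_fst (hg.not_conn_join h₀ h₁) (v := c)
    (by rw [hg.fst]; exact Conn.refl _ _ c)
  rw [h, hg.fst, hg.snd, hg.clusterF_join_c h₀ h₁, hg.clusterF_join_u h₀ h₁]

/-! ### `e` closed -/

omit [DecidableEq V] in
/-- `X_c(ω₀ ⊔ ω₁) = X_c(ω₀)`. -/
theorem IsGlue.xCluster_closed : G.xCluster x c (join ω₀ ω₁) = G.xCluster x c ω₀ := by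
  unfold xCluster
  rw [hg.clusterF_join_c h₀ h₁]

omit [DecidableEq V] in
/-- `K_c(ω₀ ⊔ ω₁) = K_c(ω₀)`. -/
theorem IsGlue.kCluster_closed : G.kCluster K c (join ω₀ ω₁) = G.kCluster K c ω₀ := by
  unfold kCluster
  rw [hg.clusterF_join_c h₀ h₁]

/-- `ρ·N_c(ω₀ ⊔ ω₁) = N_c(ω₀)·n̄(ω₁)`. -/
theorem IsGlue.nbarOff_closed :
    rhoAll x * G.nbarOff x c (join ω₀ ω₁) = G.nbarOff x c ω₀ * G.nbar x ω₁ :=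
  nbarOff_join hg.vdisj h₀ h₁ x hg.avoid_c

/-! ### `e` open -/

/-- `X_c(ω⁺) = X_c(ω₀)·X_u(ω₁)`. -/
theorem IsGlue.xCluster_open :
    G.xCluster x c (Function.update (join ω₀ ω₁) e true) = G.xCluster x c ω₀ * G.xCluster x u ω₁ := by
  unfold xCluster
  rw [hg.clusterF_open h₀ h₁, Finset.prod_union (hg.disjoint_clusters h₀ h₁)]

/-- `K_c(ω⁺) = K_c(ω₀)·K_u(ω₁)`. -/
theorem IsGlue.kCluster_open :
    G.kCluster K c (Function.update (join ω₀ ω₁) e true) = G.kCluster K c ω₀ * G.kCluster K u ω₁ := by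
  unfold kCluster
  rw [hg.clusterF_open h₀ h₁, Finset.prod_union (hg.disjoint_clusters h₀ h₁)]

/-- **`ρ·N_c(ω⁺) = N_c(ω₀)·N_u(ω₁)`** for cells in `[0, 1]`. -/
theorem IsGlue.nbarOff_open (hx : ∀ v, 0 ≤ x v ∧ x v ≤ 1) :
    rhoAll x * G.nbarOff x c (Function.update (join ω₀ ω₁) e true) =
      G.nbarOff x c ω₀ * G.nbarOff x u ω₁ := by
  have hm := merge_nbar_identity (G := G) x (hg.not_conn_join h₀ h₁)
  rw [hg.fst, hg.snd, hg.xCluster_closed h₀ h₁ x] at hm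
  have hXu : G.xCluster x u (join ω₀ ω₁) = G.xCluster x u ω₁ := by
    unfold xCluster
    rw [hg.clusterF_join_u h₀ h₁]
  rw [hXu] at hm
  -- n̄(ω⁺) = (2 − X_c X_u)·N_c(ω⁺), n̄(ω₀ ⊔ ω₁) = (2 − X_c)·N_c(ω₀ ⊔ ω₁), n̄(ω₁) = (2 − X_u)·N_u(ω₁)
  rw [nbar_eq_mul_nbarOff G x c (Function.update (join ω₀ ω₁) e true), hg.xCluster_open h₀ h₁ x,
    nbar_eq_mul_nbarOff G x c (join ω₀ ω₁), hg.xCluster_closed h₀ h₁ x] at hm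
  have hcl := hg.nbarOff_closed h₀ h₁ x
  rw [nbar_eq_mul_nbarOff G x u ω₁] at hcl
  have hXc0 := xCluster_mem (G := G) hx c ω₀
  have hXu1 := xCluster_mem (G := G) hx u ω₁
  have hp1 : 0 < 2 - G.xCluster x c ω₀ := by linarith
  have hp2 : 0 < 2 - G.xCluster x u ω₁ := by linarith
  have hp3 : 0 < 2 - G.xCluster x c ω₀ * G.xCluster x u ω₁ := by nlinarith
  -- from hm: (2 − X_c)(2 − X_u)(2 − X_cX_u)N_c(ω⁺) = (2 − X_cX_u)(2 − X_c)N_c(ω₀ ⊔ ω₁)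
  have h1 : (2 - G.xCluster x u ω₁) * G.nbarOff x c (Function.update (join ω₀ ω₁) e true) =
      G.nbarOff x c (join ω₀ ω₁) := by
    have := mul_right_cancel₀ (mul_pos hp3 hp1).ne'
      (show ((2 - G.xCluster x u ω₁) * G.nbarOff x c (Function.update (join ω₀ ω₁) e true)) *
        ((2 - G.xCluster x c ω₀ * G.xCluster x u ω₁) * (2 - G.xCluster x c ω₀)) =
        G.nbarOff x c (join ω₀ ω₁) * ((2 - G.xCluster x c ω₀ * G.xCluster x u ω₁) *
          (2 - G.xCluster x c ω₀)) by linear_combination hm)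
    exact this
  -- multiply by ρ and cancel (2 − X_u)
  have h2 : (2 - G.xCluster x u ω₁) * (rhoAll x *
      G.nbarOff x c (Function.update (join ω₀ ω₁) e true)) =
      (2 - G.xCluster x u ω₁) * (G.nbarOff x c ω₀ * G.nbarOff x u ω₁) := by
    linear_combination rhoAll x * h1 + hcl
  exact mul_left_cancel₀ hp2.ne' h2

/-! ### Complements -/

omit hg h₀ h₁ x K in
/-- The complement of a join of configurations of disjoint edge sets is the join of the complements
(inside the two parts). -/
theorem complIn_union_join {F₀ F₁ : Finset E} (hd : Disjoint F₀ F₁) {ω₀ ω₁ : Config E}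
    (h₀ : ω₀ ∈ configsIn F₀) (h₁ : ω₁ ∈ configsIn F₁) :
    complIn (F₀ ∪ F₁) (join ω₀ ω₁) = join (complIn F₀ ω₀) (complIn F₁ ω₁) := by
  funext f
  simp only [complIn, join_apply]
  by_cases hf0 : f ∈ F₀
  · have hf1 : f ∉ F₁ := Finset.disjoint_left.1 hd hf0
    have : ω₁ f = false := by
      cases h : ω₁ f
      · rfl
      · exact absurd ((mem_configsIn.1 h₁) f h) hf1
    simp [hf0, hf1, this]
  · by_cases hf1 : f ∈ F₁
    · have : ω₀ f = false := by
        cases h : ω₀ f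
        · rfl
        · exact absurd ((mem_configsIn.1 h₀) f h) hf0
      simp [hf0, hf1, this]
    · simp [hf0, hf1]

omit [Fintype V] [DecidableEq V] K in
/-- The complement inside `F₀ ∪ insert e F₁` of the join (`e` closed) is the join of the complements
with `e` opened. -/
theorem IsGlue.complIn_closed :
    complIn (F₀ ∪ insert e F₁) (join ω₀ ω₁) =
      Function.update (join (complIn F₀ ω₀) (complIn F₁ ω₁)) e true := by
  have hmem : join ω₀ ω₁ ∈ configsIn ((F₀ ∪ insert e F₁).erase e) := by
    rw [mem_configsIn]
    intro f hf
    have := (mem_configsIn.1 (join_mem_configsIn h₀ h₁)) f hf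
    refine Finset.mem_erase.2 ⟨?_, ?_⟩
    · rintro rfl
      rw [Finset.mem_union] at this
      rcases this with h | h
      · exact hg.notMem₀ h
      · exact hg.notMem₁ h
    · rw [Finset.mem_union] at this ⊢
      rcases this with h | h
      · exact Or.inl h
      · exact Or.inr (Finset.mem_insert_of_mem h)
  rw [complIn_eq_update_of_mem (Finset.mem_union_right _ (Finset.mem_insert_self e F₁)) hmem]
  congr 1
  have : (F₀ ∪ insert e F₁).erase e = F₀ ∪ F₁ := by
    rw [Finset.erase_union_distrib, Finset.erase_eq_of_notMem hg.notMem₀, Finset.erase_insert hg.notMem₁]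
  rw [this, complIn_union_join hg.vdisj.disjoint h₀ h₁]

omit [Fintype V] [DecidableEq V] K in
/-- The complement inside `F₀ ∪ insert e F₁` of the join with `e` opened is the join of the
complements. -/
theorem IsGlue.complIn_open :
    complIn (F₀ ∪ insert e F₁) (Function.update (join ω₀ ω₁) e true) =
      join (complIn F₀ ω₀) (complIn F₁ ω₁) := by
  rw [complIn_update_true]
  have : (F₀ ∪ insert e F₁).erase e = F₀ ∪ F₁ := by
    rw [Finset.erase_union_distrib, Finset.erase_eq_of_notMem hg.notMem₀, Finset.erase_insert hg.notMem₁]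
  rw [this, complIn_union_join hg.vdisj.disjoint h₀ h₁]

end Glue

end MultiGraph

end PercRepro
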